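import Literature.AnabelianGeometry.AbsoluteAnabelian.AbsTopIII.BiAnabelianCoresProofs
import Literature.AnabelianGeometry.AbsoluteAnabelian.AbsTopIII.BiAnabelianDeltaFamilyProofs
import Literature.AnabelianGeometry.AbsoluteAnabelian.AbsTopIII.BiAnabelianObservableProofs
import Literature.AnabelianGeometry.AbsoluteAnabelian.AbsTopIII.BiAnabelianTelecoreIncompatibilityProofs
import Literature.AnabelianGeometry.AbsoluteAnabelian.AbsTopIII.BiAnabelianNexusProofs
import Mathlib.CategoryTheory.Types.Basic
import Mathlib.CategoryTheory.SingleObj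
import Mathlib.CategoryTheory.PUnit
import Mathlib.Algebra.Group.Nat.TypeTags
import HarnessLib

/-!
# [AbsTopIII] §3, Corollary 3.7 assembled from its discharged items: the residual MODEL inputs,
# and a kernel CONSISTENCY witness for them

Mochizuki, *Topics in Absolute Anabelian Geometry III*, §3, Corollary 3.7 (i)–(v) ("Mono-anabelian
MLF-Galois Log-Frobenius Compatibility", bi-anabelian version) pp. 86–89 of the author's kurims
manuscript (lit key `paper:url-5493eb38cbb7`; bib key `MochizukiAbsTopIII2015`).  PROOF-ONLY companion
(abc-iut cell, seat abc-iut-w5-d210; census/assembly row for nodes `AbsTopIII:Cor3.7(i)`–`(v)`, same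
pattern as `AutHolLogFrobeniusAssembly.lean` / `LogFrobeniusToyWitness.lean` for Cor. 4.5).  No notion
is declared; the statements are abc-iut-L4-t9's `BiAnabelianSetting.Cor_3_7_*` over the ABSTRACT
bi-anabelian setting `𝔖 : BiAnabelianSetting X E N` (`MonoAnabelianComparisonMLF.lean`,
`BiAnabelianDiagrams.lean`, `BiAnabelianTelecore.lean`).

What the tree already has over an abstract setting: (i) `cor_3_7_i_holds` (t9), (ii)
`cor_3_7_ii_holds θ` (abc-iut-L4-t12, over the bi-anabelian lift datum `θ` of Cor. 1.10), (iii)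
`cor_3_7_iii_holds`, (iv) `cor_3_7_iv_of_obstruction` (modulo the Lemma-3.4 obstruction
`LogKernelObstruction`), (v) `cor_3_7_v_of_lift θ` (modulo the id-rigidity of `𝒳`, Prop. 3.2 (iv)).
This file adds:

* `cor_3_7_of_inputs` — **Cor. 3.7 (i)–(v) REDUCED TO ITS PRINTED MODEL INPUTS**: the lift datum
  `θ^bi` (Cor. 1.10 applied relatively, p. 87), the Lemma-3.4 obstruction (Lemma 3.4 p. 74 at the MLF
  model), and the id-rigidity of `𝒳 = 𝒞^{MLF-sB}_{T𝔽}` (Prop. 3.2 (iv)) — nothing else;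
* `logKernelObstruction_of_functor` — the shape of the model half of the Lemma-3.4 input ("by
  writing out explicitly the meaning of `ζ'₁ = id` … a contradiction to Lemma 3.4", proof of Cor. 3.6
  (iv) p. 81, to which Cor. 3.7's proof p. 88 refers): any functor `𝒩 ⥤ Type` ("underlying arithmetic
  datum") under which `λ^×(a) ≫ ι_{log,x₀}` and `ι_{×,x₀}` become different maps yields the obstruction;
* `cor_3_7_hypotheses_satisfiable` — a kernel witness that the three inputs are JOINTLY SATISFIABLE
  and the assembled Cor. 3.7 then holds: inside the proof (nothing enters the library) a bi-anabelian
  setting with `𝒳 = 𝔈` the one-object discrete category, `𝒩` the one-object category of `(ℕ,+)`,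
  `ι_log = 1`, `ι_× = 2`, the tautological lift datum — the first inhabitant of `BiAnabelianSetting`
  and of `FiberSquare.BiAnabelianLift` in the tree.  A toy, not the MLF data of Def. 3.1: it certifies
  only that the abstract Cor. 3.7 layer is consistent (not vacuous).

Refereed pre-IUT anabelian geometry; nothing here bears on [IUTchIII] Cor. 3.12 or takes a side;
typed ≠ proved for the geometric instance.
-/

namespace Literature.AnabelianGeometry.AbsoluteAnabelian.AbsTopIII

open _root_.CategoryTheory _root_.CategoryTheory.Limits

universe w u

namespace BiAnabelianSetting

variable {X E N : Type u} [Category.{u} X] [Category.{u} E] [Category.{u} N]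
  (𝔖 : BiAnabelianSetting X E N)

/-! ### The Lemma-3.4 obstruction from a separating underlying-map functor -/

/-- **"Writing out explicitly the meaning of `ζ'₁ = id` … a contradiction to Lemma 3.4"** (proof of
Cor. 3.6 (iv) p. 81; Cor. 3.7 (iv) p. 88 "follows immediately from Lemma 3.4 … via the argument applied
in the proof of Corollary 3.6, (iv)"), abstractly: if at some object `x₀` of `𝒳` a functor
`Φ : 𝒩 ⥤ Type` (at the model: "the arithmetic datum of type `TS`") sends, for every isomorphism
`a : x₀ ⥲ log x₀`, the composite `λ^×(a) ≫ ι_{log,x₀}` and `ι_{×,x₀}` to DIFFERENT maps (at the model: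
`α^pf((𝒪^▷)^pf) ⊄ (𝒪^×)^pf`, Lemma 3.4), then the setting has the `LogKernelObstruction`.
[cite: MochizukiAbsTopIII2015, Cor 3.7 (iv) p.88] -/
theorem logKernelObstruction_of_functor (Φ : N ⥤ Type w) (x₀ : X)
    (h : ∀ a : x₀ ⟶ 𝔖.log.obj x₀, IsIso a →
      Φ.map (𝔖.lamTimes.map a ≫ 𝔖.iotaLog.app x₀) ≠ Φ.map (𝔖.iotaTimes.app x₀)) :
    𝔖.LogKernelObstruction :=
  ⟨x₀, fun a ha heq => h a ha (by rw [heq])⟩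

/-! ### Corollary 3.7 assembled: the residual model inputs, by name -/

/-- **[AbsTopIII] Cor. 3.7 (i)–(v) over an abstract bi-anabelian setting, REDUCED TO ITS PRINTED
MODEL INPUTS**: the bi-anabelian lift datum `θ^bi` of Cor. 1.10 ("if one applies Corollary 1.10 to
the various objects …", p. 87), the Lemma-3.4 obstruction (first incompatibility of (iv), p. 88 / p. 81),
and the id-rigidity of `𝒳` (total `□`-rigidity of (v) "follows immediately from Proposition 3.2, (iv)",
p. 89 / p. 82).  Items BY NAME: (i) `cor_3_7_i_holds` (abc-iut-L4-t9), (ii) `cor_3_7_ii_holds`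
(abc-iut-L4-t12), (iii) `cor_3_7_iii_holds`, (iv) `cor_3_7_iv_of_obstruction`, (v) `cor_3_7_v_of_lift`.
[cite: MochizukiAbsTopIII2015, Cor 3.7 pp.86–89] -/
theorem cor_3_7_of_inputs (θ : FiberSquare.BiAnabelianLift 𝔖.gal) (hobs : 𝔖.LogKernelObstruction)
    (hX : IsIdRigid X) :
    𝔖.Cor_3_7_i ∧ 𝔖.Cor_3_7_ii θ ∧
      Literature.AnabelianGeometry.AbsoluteAnabelian.AbsTopIII.BiAnabelianSetting.Cor_3_7_iii 𝔖 ∧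
      𝔖.Cor_3_7_iv θ ∧ 𝔖.Cor_3_7_v :=
  ⟨𝔖.cor_3_7_i_holds, 𝔖.cor_3_7_ii_holds θ, 𝔖.cor_3_7_iii_holds, 𝔖.cor_3_7_iv_of_obstruction θ hobs,
    𝔖.cor_3_7_v_of_lift θ hX⟩

end BiAnabelianSetting

/-! ### Consistency of the inputs (kernel witness) -/

/-- **The inputs of `cor_3_7_of_inputs` are jointly satisfiable**, and Cor. 3.7 (i)–(v) then holds:
there IS a bi-anabelian setting (`𝒳 = 𝔈` the one-object discrete category, `gal = 𝟭`, `log = 𝟭`,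
`𝒩` the one-object category of the monoid `(ℕ,+)`, `λ^× = λ^{×pf}` constant, `ι_log = 1`, `ι_× = 2`)
carrying a bi-anabelian lift datum (the tautological one), having the Lemma-3.4 obstruction
(`1 ≠ 2` in `(ℕ,+)` at the identity isomorphism) and id-rigid `𝒳`.  First inhabitant of
`BiAnabelianSetting` / `FiberSquare.BiAnabelianLift` in the tree; a toy certifying that the abstract
Cor. 3.7 layer is not vacuous — it says nothing about the MLF data of Def. 3.1.
[cite: MochizukiAbsTopIII2015, Cor 3.7 pp.86–89] -/
theorem cor_3_7_hypotheses_satisfiable :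
    ∃ (X E N : Type) (_ : Category.{0} X) (_ : Category.{0} E) (_ : Category.{0} N)
      (𝔖 : BiAnabelianSetting X E N) (θ : FiberSquare.BiAnabelianLift 𝔖.gal),
      𝔖.LogKernelObstruction ∧ IsIdRigid X ∧
      (𝔖.Cor_3_7_i ∧ 𝔖.Cor_3_7_ii θ ∧
        Literature.AnabelianGeometry.AbsoluteAnabelian.AbsTopIII.BiAnabelianSetting.Cor_3_7_iii 𝔖 ∧
        𝔖.Cor_3_7_iv θ ∧ 𝔖.Cor_3_7_v) := by
  let L : Discrete PUnit.{1} ⥤ SingleObj (Multiplicative ℕ) :=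
    (Functor.const (Discrete PUnit.{1})).obj (SingleObj.star _)
  -- `ι_log = 1 : log ⋙ λ^× ⟶ λ^{×pf}` (with `log = 𝟭`), `ι_× = 2 : λ^× ⟶ λ^{×pf}`
  let one : 𝟭 (Discrete PUnit.{1}) ⋙ L ⟶ L :=
    Discrete.natTrans fun _ => (Multiplicative.ofAdd (1 : ℕ) : Multiplicative ℕ)
  let two : L ⟶ L := Discrete.natTrans fun _ => (Multiplicative.ofAdd (2 : ℕ) : Multiplicative ℕ)
  let 𝔖 : BiAnabelianSetting (Discrete PUnit.{1}) (Discrete PUnit.{1}) (SingleObj (Multiplicative ℕ)) :=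
    { gal := 𝟭 _, log := 𝟭 _, logIsoId := Iso.refl _,
      lamTimes := L, lamTimesPf := L, iotaLog := one, iotaTimes := two,
      spaceGal := (Functor.const (SingleObj (Multiplicative ℕ))).obj ⟨PUnit.unit⟩,
      lamTimesGal := Functor.punitExt _ _, lamTimesPfGal := Functor.punitExt _ _ }
  -- the tautological bi-anabelian lift datum over `gal = 𝟭` of the discrete one-object category
  let θ : FiberSquare.BiAnabelianLift 𝔖.gal :=
    { θbi := NatIso.ofComponents (fun o => eqToIso (Subsingleton.elim _ _))
        (fun _ => Subsingleton.elim _ _),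
      map_θbi := fun _ => Subsingleton.elim _ _ }
  have hX : IsIdRigid (Discrete PUnit.{1}) :=
    fun α => Iso.ext (NatTrans.ext (funext fun _ => Subsingleton.elim _ _))
  have hobs : 𝔖.LogKernelObstruction := by
    refine ⟨⟨PUnit.unit⟩, fun a _ h => ?_⟩
    -- `λ^×(a) ≫ ι_log = 1` while `ι_× = 2` in `(ℕ,+)`
    simp [𝔖, L, one, two, SingleObj.comp_as_mul, SingleObj.id_as_one, Discrete.natTrans] at h
  exact ⟨_, _, _, inferInstance, inferInstance, inferInstance, 𝔖, θ, hobs, hX,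
    𝔖.cor_3_7_of_inputs θ hobs hX⟩

end Literature.AnabelianGeometry.AbsoluteAnabelian.AbsTopIII
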